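import Summits.QuantumFields.YangMills.Theorems.FluctuationComparisonRegPrIntLOrganTangentSquareStability
import Summits.QuantumFields.YangMills.Theorems.FluctuationComparisonRegPrIntLOrganTangentAnchorFreeOscillation
import HarnessLib

/-!
# Crux `FluctuationComparisonRegPrIntL` (stmt-QuantumFields-20520, rung R3), PATH-B organ — «NEAR DISPLACEMENT FROM ONE-BOND DISPLACEMENT» (the `hdisp`-CHAINING brick of
# DISCHARGE-SPEC v1.4 §9 (sq3); LEAD w3 g26 №38 (2)–(3) ∕ №42 (N1)–(N4); DEFINITION-FREE)

Cell `ym3-torus` (YM ladder rung R3 = continuum `SU(2)` Yang–Mills on the three-torus — a RUNG: NOT d = 4, NOT infinite volume, NOT a mass gap, NOT Clay).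
Width seat `ym3-torus-px20` (gen 21); `--kind proof --supports stmt-QuantumFields-20520 --as helper`, count-neutral, no registry ∕ binder ∕ `Lines/` edit, default
heartbeats, `autoImplicit false`.  Over ✓p816275 `…OrganTangentSquareStability` (its `hdisp` binder text and `plaqSmall_chart_along_square_of_margin`), ✓p817898
`…OrganTangentRelPathWindow` (relational paths ∕ squares — the shapes §1–§2 speak), ✓`eq_update_of_rel` (`…OrganTangentSeedHClause`), ✓`expPt_mul_expPt_neg`
(`…OrganTangentAnchorFreeOscillation`).

WHY (the near-pair «sq» programme, LEAD №38 ∕ ★★OWNER №416 ∕ w4 g24 TN-HGLOB-FRAME + INSTANCE TABLE 96d7f6a7).  The frozen rows' window-to-window displacement letter `Dw`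
(`hglob`∕`hglobW`: ANY two window points) is not dischargeable in print's frames for FAR pairs; but every consumer in the tree instantiates NEAR pairs only — value point and
law point among the corners of ONE admissible coarse square, or the law point on a relational one-bond path ∕ square spanned by such corners.  For near pairs no `Dw` is
needed: the ONE-BOND plaquette displacement clause `hdisp` of the chart (letters `DP ≤ Db`; [Balaban1985Variational] Prop 9 (190) + continuity along ONE move — print) CHAINS
along the ≤ 3 admissible moves joining the two points, each move costing `Db·rc` in `dist1` of every fine plaquette.  This file is that chaining, as lattice-geometry
bookkeeping over the HYPOTHESIS clause `hdisp` (generic chart `T`, exactly ✓p816275's binder text), plus the docking forms that replace `hglob` by NOTHING: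
* §1 ONE MOVE, integrated (`s = 1`): forward ★`dist1_chart_update_le` (`+ Db·rc`); the INVERSE-MOVE ALGEBRA `update (update U b (U b·e^w)) b (…·e^{−w}) = U`
  (✓`expPt_mul_expPt_neg`), hence the REVERSE bound ★`dist1_chart_le_update`; relational editions (`hoff`∕`hon`, no `update` in the hypotheses: `dist1_chart_rel_le`,
  `dist1_chart_le_rel`) and relational PATH points `X s`, `|s| ≤ 1` (★`dist1_chart_relPath_le` ∕ ★`dist1_chart_le_relPath` — LEAD №42 (N1): the law point → its own base);
* §2 THE ADMISSIBLE SQUARE `U, V = U·e^v@b, W = U·e^{v′}@b′, Y = V·e^{v′}@b′` (the seed clause's relational shape): all pairwise two-sided bounds with their move counts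
  (`U–V`, `U–W`, `V–Y`: 1; `U–Y`, `V–W`: 2; `W–Y`: 3 — `b = b′` is allowed, so `W–Y` goes `W → U → V → Y`) — ★`dist1_chart_square_corners`; uniformly ★`dist1_chart_corner_corner_le`:
  ANY two corners differ by `≤ 3·(Db·rc)` (LEAD №42 (N2)); relational square point `X s s′ ↔ V00`: `≤ 2·(Db·rc)` (★`dist1_chart_relSquare`, (N3));
* §3 DOCKING, generic: `plaqSmall_of_near`; ★`plaqSmall_chart_along_square_of_lawCorner` = ✓p816275's `…_of_lawPoint` with `hglob` REPLACED by «the law point is a corner»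
  (room `θw + 4·Db·rc ≤ θf`: ≤ 2 moves corner → base `U`, then ✓`plaqSmall_chart_along_square_of_margin`'s `(Db + Db)·rc`);
* §4 (SEQUEL FILE `…OrganTangentNearStability.lean`, same seat) DOCKING at the T³ record ((N4), (L30)'s `hstabW` SHAPE near-quantified): `hstab_of_near` — `mwCut (Φ (Xw, z)) ≠ 0` + `hχsupp` + ✓`descendTo_self` put `Φ (Xw, z)` in the
  `24∕25·θ_Ts`-window, so ANY `U` with `dist1 (Φ (U, z)) ≤ dist1 (Φ (Xw, z)) + D` plaquette-wise has `dist1 (plaqHol (Φ (U, z)) p) ≤ c·θ_Ts` under room `24∕25·θ_Ts + D ≤ c·θ_Ts`;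
  instances from the row's `hdisp` (base in the `θ_j`-window, `‖v‖ ≤ rc·(θ_j∕4)`, cap `∀ p b, DP p b ≤ Db`) and the guard `(1 + 16·√3·rc)·(θ_j∕4) ≤ θ_j`:
  ★★`hstab_corners_of_hdisp` (value AND law point any two corners of one admissible `θ_j∕4`-square; `D = 3·(Db·rc)`, i.e. ROOM `24∕25·θ_Ts + 3·(Db·rc) ≤ c·θ_Ts` — this file's `k = 3`),
  ★`hstab_relPath_base_of_hdisp` (law point `X s`, `s ∈ Icc 0 1`, on the relational path from `U₂`; value `U₂`: `k = 1`), ★`hstab_relPath_of_move_of_hdisp` (value one admissible move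
  away from the path's base, either orientation: `k = 2`), ★`hstab_relSquare_base_of_hdisp` (law point `X s s′` of the relational square from `V00`, value `V00`: `k = 2`) — all `≤` the
  `k = 3` room.  So (I-geo)sq needs NO `hglobW`: near stability is DERIVED from `hdisp` (LEAD №38 (2)).
INPUT LEFT TO PRINT: the displacement letters `DP` of Bałaban's minimiser-following chart ([Balaban1985Variational] Thm 1 (10) p.279, Prop 9 (190) p.309) — NOT constructed here.

HONEST FRAMING: `dist1`∕`Function.update` bookkeeping over a HYPOTHESIS clause; nothing of Bałaban's analysis is asserted or proved; `SpreadFibreLawH(J)` ∕ `OrganDischargeInputsHJ`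
are HYPOTHESIS rows, UNDISCHARGED and exactly as open; LIN″, JEN″, JVARᵘ-H″, O1ᵘ-H v2.2, S1aᴴ, S3ᴴ, S2α′, S2β, 26243, the five registered stubs of `Lines/semiclassical_s2beta.lean`
(registry 3732b7df untouched), crux 20520 `FluctuationComparisonRegPrIntL` and `YM3TorusSU2` are NOT proved; no summit ∕ sub-problem statement is proved; rung R3 = SU(2) YM₃ on T³
at fixed lattice data — NOT d = 4, NOT infinite volume, NOT a mass gap, NOT Clay; the Yang–Mills mass gap is NOT proved.  [folklore]
-/

set_option autoImplicit false

noncomputable section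

namespace Summit.QuantumFields.YangMills.Theorems.OrganTangentNearDisplacement

open Function Set
open Literature.MathematicalPhysics.QuantumFieldTheory.Balaban1983to89
open T4CubeChartExp (expPt)
open Summit.QuantumFields.YangMills.Theorems.OrganTangentSeedHClause (eq_update_of_rel)
open Summit.QuantumFields.YangMills.Theorems.OrganTangentAnchorFreeOscillation (expPt_mul_expPt_neg)
open Summit.QuantumFields.YangMills.Theorems.OrganTangentSquareStability (plaqSmall_chart_along_square_of_margin)

/-! ## §1 One admissible move, integrated; the inverse move; relational editions -/

section Generic

variable {P Q : Params} {j i : ℕ} [DecidableEq (PBond P j)]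

/-- ★ **ONE MOVE, FORWARD**: under the one-bond plaquette displacement clause `hdisp` on the coarse window `θc′` (letters `DP`, uniform cap `Db`), a right exponential move
`U ↦ U·e^w@b` with `‖w‖ ≤ rc·θc` from a `θc′`-window point displaces every fine plaquette of the image by at most `Db·rc` in `dist1`. [folklore] -/
theorem dist1_chart_update_le {θc θc' rc Db : ℝ} (hθc : 0 < θc)
    (T : GaugeField P j (Matrix.specialUnitaryGroup (Fin 2) ℂ) → GaugeField Q i (Matrix.specialUnitaryGroup (Fin 2) ℂ))
    (DP : Plaq Q i → PBond P j → ℝ)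
    (hdisp : ∀ (U : GaugeField P j (Matrix.specialUnitaryGroup (Fin 2) ℂ)), PlaqSmall θc' U →
      ∀ (b : PBond P j) (v : Fin 3 → ℝ), ‖v‖ ≤ rc * θc → ∀ s ∈ Icc (0 : ℝ) 1, ∀ p : Plaq Q i,
        dist1 (GaugeField.plaqHol (T (update U b (U b * expPt (s • v)))) p)
          ≤ dist1 (GaugeField.plaqHol (T U) p) + DP p b * (‖v‖ / θc))
    (hDb0 : 0 ≤ Db) (hDb : ∀ p b, DP p b ≤ Db)
    (U : GaugeField P j (Matrix.specialUnitaryGroup (Fin 2) ℂ)) (hU : PlaqSmall θc' U) (b : PBond P j) (w : Fin 3 → ℝ) (hw : ‖w‖ ≤ rc * θc)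
    (p : Plaq Q i) :
    dist1 (GaugeField.plaqHol (T (update U b (U b * expPt w))) p) ≤ dist1 (GaugeField.plaqHol (T U) p) + Db * rc := by
  have h1 := hdisp U hU b w hw 1 ⟨zero_le_one, le_rfl⟩ p
  rw [one_smul] at h1
  have hσ : ‖w‖ / θc ≤ rc := by rw [div_le_iff₀ hθc]; exact hw
  have hσ0 : 0 ≤ ‖w‖ / θc := div_nonneg (norm_nonneg _) hθc.le
  have h2 : DP p b * (‖w‖ / θc) ≤ Db * rc :=
    (mul_le_mul_of_nonneg_right (hDb p b) hσ0).trans (mul_le_mul_of_nonneg_left hσ hDb0)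
  linarith

omit [DecidableEq (PBond P j)] in
/-- **INVERSE-MOVE ALGEBRA**: moving back along the same bond with `−w` returns to `U` (`e^w·e^{−w} = 1`, ✓`expPt_mul_expPt_neg`). [folklore] -/
theorem update_update_mul_expPt_neg [DecidableEq (PBond P j)] (U : GaugeField P j (Matrix.specialUnitaryGroup (Fin 2) ℂ)) (b : PBond P j) (w : Fin 3 → ℝ) :
    update (update U b (U b * expPt w)) b ((update U b (U b * expPt w)) b * expPt (-w)) = U := by
  rw [update_idem, update_self, mul_assoc, expPt_mul_expPt_neg, mul_one, update_eq_self]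

/-- ★ **ONE MOVE, REVERSE**: if the MOVED point `U·e^w@b` is in the `θc′`-window, the base image is within `Db·rc` of the moved image (apply the clause at the moved point
with `−w` and the inverse-move algebra). [folklore] -/
theorem dist1_chart_le_update {θc θc' rc Db : ℝ} (hθc : 0 < θc)
    (T : GaugeField P j (Matrix.specialUnitaryGroup (Fin 2) ℂ) → GaugeField Q i (Matrix.specialUnitaryGroup (Fin 2) ℂ))
    (DP : Plaq Q i → PBond P j → ℝ)
    (hdisp : ∀ (U : GaugeField P j (Matrix.specialUnitaryGroup (Fin 2) ℂ)), PlaqSmall θc' U →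
      ∀ (b : PBond P j) (v : Fin 3 → ℝ), ‖v‖ ≤ rc * θc → ∀ s ∈ Icc (0 : ℝ) 1, ∀ p : Plaq Q i,
        dist1 (GaugeField.plaqHol (T (update U b (U b * expPt (s • v)))) p)
          ≤ dist1 (GaugeField.plaqHol (T U) p) + DP p b * (‖v‖ / θc))
    (hDb0 : 0 ≤ Db) (hDb : ∀ p b, DP p b ≤ Db)
    (U : GaugeField P j (Matrix.specialUnitaryGroup (Fin 2) ℂ)) (b : PBond P j) (w : Fin 3 → ℝ) (hw : ‖w‖ ≤ rc * θc)
    (hU' : PlaqSmall θc' (update U b (U b * expPt w))) (p : Plaq Q i) :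
    dist1 (GaugeField.plaqHol (T U) p) ≤ dist1 (GaugeField.plaqHol (T (update U b (U b * expPt w))) p) + Db * rc := by
  have hw' : ‖-w‖ ≤ rc * θc := by rwa [norm_neg]
  have h := dist1_chart_update_le hθc T DP hdisp hDb0 hDb _ hU' b (-w) hw' p
  rwa [update_update_mul_expPt_neg] at h

/-- Relational edition, FORWARD: `V` agrees with `U` off `b` and `V b = U b·e^w` (the seed clause's shape, no `update` in the hypotheses). [folklore] -/
theorem dist1_chart_rel_le {θc θc' rc Db : ℝ} (hθc : 0 < θc)
    (T : GaugeField P j (Matrix.specialUnitaryGroup (Fin 2) ℂ) → GaugeField Q i (Matrix.specialUnitaryGroup (Fin 2) ℂ))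
    (DP : Plaq Q i → PBond P j → ℝ)
    (hdisp : ∀ (U : GaugeField P j (Matrix.specialUnitaryGroup (Fin 2) ℂ)), PlaqSmall θc' U →
      ∀ (b : PBond P j) (v : Fin 3 → ℝ), ‖v‖ ≤ rc * θc → ∀ s ∈ Icc (0 : ℝ) 1, ∀ p : Plaq Q i,
        dist1 (GaugeField.plaqHol (T (update U b (U b * expPt (s • v)))) p)
          ≤ dist1 (GaugeField.plaqHol (T U) p) + DP p b * (‖v‖ / θc))
    (hDb0 : 0 ≤ Db) (hDb : ∀ p b, DP p b ≤ Db)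
    {U V : GaugeField P j (Matrix.specialUnitaryGroup (Fin 2) ℂ)} {b : PBond P j} {w : Fin 3 → ℝ}
    (hoff : ∀ e, e ≠ b → V e = U e) (hon : V b = U b * expPt w) (hw : ‖w‖ ≤ rc * θc) (hU : PlaqSmall θc' U) (p : Plaq Q i) :
    dist1 (GaugeField.plaqHol (T V) p) ≤ dist1 (GaugeField.plaqHol (T U) p) + Db * rc := by
  rw [eq_update_of_rel hoff hon]
  exact dist1_chart_update_le hθc T DP hdisp hDb0 hDb U hU b w hw p

/-- Relational edition, REVERSE (`V` in the `θc′`-window). [folklore] -/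
theorem dist1_chart_le_rel {θc θc' rc Db : ℝ} (hθc : 0 < θc)
    (T : GaugeField P j (Matrix.specialUnitaryGroup (Fin 2) ℂ) → GaugeField Q i (Matrix.specialUnitaryGroup (Fin 2) ℂ))
    (DP : Plaq Q i → PBond P j → ℝ)
    (hdisp : ∀ (U : GaugeField P j (Matrix.specialUnitaryGroup (Fin 2) ℂ)), PlaqSmall θc' U →
      ∀ (b : PBond P j) (v : Fin 3 → ℝ), ‖v‖ ≤ rc * θc → ∀ s ∈ Icc (0 : ℝ) 1, ∀ p : Plaq Q i,
        dist1 (GaugeField.plaqHol (T (update U b (U b * expPt (s • v)))) p)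
          ≤ dist1 (GaugeField.plaqHol (T U) p) + DP p b * (‖v‖ / θc))
    (hDb0 : 0 ≤ Db) (hDb : ∀ p b, DP p b ≤ Db)
    {U V : GaugeField P j (Matrix.specialUnitaryGroup (Fin 2) ℂ)} {b : PBond P j} {w : Fin 3 → ℝ}
    (hoff : ∀ e, e ≠ b → V e = U e) (hon : V b = U b * expPt w) (hw : ‖w‖ ≤ rc * θc) (hV : PlaqSmall θc' V) (p : Plaq Q i) :
    dist1 (GaugeField.plaqHol (T U) p) ≤ dist1 (GaugeField.plaqHol (T V) p) + Db * rc := by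
  have hV' : PlaqSmall θc' (update U b (U b * expPt w)) := by rw [← eq_update_of_rel hoff hon]; exact hV
  have h := dist1_chart_le_update hθc T DP hdisp hDb0 hDb U b w hw hV' p
  rwa [← eq_update_of_rel hoff hon] at h

omit [DecidableEq (PBond P j)] in
/-- `|s| ≤ 1 ⟹ ‖s • m‖ ≤ ‖m‖`. [folklore] -/
theorem norm_smul_le_of_abs_le_one {s : ℝ} (hs : |s| ≤ 1) (m : Fin 3 → ℝ) : ‖s • m‖ ≤ ‖m‖ := by
  rw [norm_smul, Real.norm_eq_abs]
  exact mul_le_of_le_one_left (norm_nonneg _) hs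

omit [DecidableEq (PBond P j)] in
/-- `s ∈ [0,1] ⟹ |s| ≤ 1`. [folklore] -/
theorem abs_le_one_of_mem_Icc {s : ℝ} (hs : s ∈ Icc (0 : ℝ) 1) : |s| ≤ 1 := by
  rw [abs_le]; constructor <;> linarith [hs.1, hs.2]

/-- ★ **RELATIONAL PATH POINT, FORWARD** (LEAD №42 (N1)): for `X` relational from `U` on bond `B′` with move `m′` (`(∀ s e, e ≠ B′ → X s e = U e)`, `(∀ s, X s B′ = U B′·e^{s•m′})`,
`‖m′‖ ≤ rc·θc`) and `|s| ≤ 1`: `dist1 (T (X s)) ≤ dist1 (T U) + Db·rc` plaquette-wise. [folklore] -/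
theorem dist1_chart_relPath_le {θc θc' rc Db : ℝ} (hθc : 0 < θc)
    (T : GaugeField P j (Matrix.specialUnitaryGroup (Fin 2) ℂ) → GaugeField Q i (Matrix.specialUnitaryGroup (Fin 2) ℂ))
    (DP : Plaq Q i → PBond P j → ℝ)
    (hdisp : ∀ (U : GaugeField P j (Matrix.specialUnitaryGroup (Fin 2) ℂ)), PlaqSmall θc' U →
      ∀ (b : PBond P j) (v : Fin 3 → ℝ), ‖v‖ ≤ rc * θc → ∀ s ∈ Icc (0 : ℝ) 1, ∀ p : Plaq Q i,
        dist1 (GaugeField.plaqHol (T (update U b (U b * expPt (s • v)))) p)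
          ≤ dist1 (GaugeField.plaqHol (T U) p) + DP p b * (‖v‖ / θc))
    (hDb0 : 0 ≤ Db) (hDb : ∀ p b, DP p b ≤ Db)
    {U : GaugeField P j (Matrix.specialUnitaryGroup (Fin 2) ℂ)} {B' : PBond P j} {m' : Fin 3 → ℝ}
    {X : ℝ → GaugeField P j (Matrix.specialUnitaryGroup (Fin 2) ℂ)}
    (hoff : ∀ s e, e ≠ B' → X s e = U e) (hon : ∀ s, X s B' = U B' * expPt (s • m')) (hm' : ‖m'‖ ≤ rc * θc)
    (hU : PlaqSmall θc' U) {s : ℝ} (hs : |s| ≤ 1) (p : Plaq Q i) :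
    dist1 (GaugeField.plaqHol (T (X s)) p) ≤ dist1 (GaugeField.plaqHol (T U) p) + Db * rc :=
  dist1_chart_rel_le hθc T DP hdisp hDb0 hDb (hoff s) (hon s) ((norm_smul_le_of_abs_le_one hs m').trans hm') hU p

/-- ★ **RELATIONAL PATH POINT, REVERSE** (LEAD №42 (N1): «the law point → its own base»): with the path point `X s` in the `θc′`-window, `dist1 (T U) ≤ dist1 (T (X s)) + Db·rc`
plaquette-wise. [folklore] -/
theorem dist1_chart_le_relPath {θc θc' rc Db : ℝ} (hθc : 0 < θc)
    (T : GaugeField P j (Matrix.specialUnitaryGroup (Fin 2) ℂ) → GaugeField Q i (Matrix.specialUnitaryGroup (Fin 2) ℂ))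
    (DP : Plaq Q i → PBond P j → ℝ)
    (hdisp : ∀ (U : GaugeField P j (Matrix.specialUnitaryGroup (Fin 2) ℂ)), PlaqSmall θc' U →
      ∀ (b : PBond P j) (v : Fin 3 → ℝ), ‖v‖ ≤ rc * θc → ∀ s ∈ Icc (0 : ℝ) 1, ∀ p : Plaq Q i,
        dist1 (GaugeField.plaqHol (T (update U b (U b * expPt (s • v)))) p)
          ≤ dist1 (GaugeField.plaqHol (T U) p) + DP p b * (‖v‖ / θc))
    (hDb0 : 0 ≤ Db) (hDb : ∀ p b, DP p b ≤ Db)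
    {U : GaugeField P j (Matrix.specialUnitaryGroup (Fin 2) ℂ)} {B' : PBond P j} {m' : Fin 3 → ℝ}
    {X : ℝ → GaugeField P j (Matrix.specialUnitaryGroup (Fin 2) ℂ)}
    (hoff : ∀ s e, e ≠ B' → X s e = U e) (hon : ∀ s, X s B' = U B' * expPt (s • m')) (hm' : ‖m'‖ ≤ rc * θc)
    {s : ℝ} (hs : |s| ≤ 1) (hXs : PlaqSmall θc' (X s)) (p : Plaq Q i) :
    dist1 (GaugeField.plaqHol (T U) p) ≤ dist1 (GaugeField.plaqHol (T (X s)) p) + Db * rc :=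
  dist1_chart_le_rel hθc T DP hdisp hDb0 hDb (hoff s) (hon s) ((norm_smul_le_of_abs_le_one hs m').trans hm') hXs p

/-! ## §2 The admissible square: all corner pairs, with their move counts; the relational square point -/

/-- ★ **THE SQUARE's CORNERS, PAIR BY PAIR** (seed-clause relational shape: `V = U·e^v@b`, `W = U·e^{v′}@b′`, `Y = V·e^{v′}@b′`; all four corners in the `θc′`-window):
the six two-sided bounds with their move counts — `U–V`, `U–W`, `V–Y`: `Db·rc`; `U–Y`, `V–W`: `2·(Db·rc)`; `W–Y`: `3·(Db·rc)` (`b = b′` allowed). [folklore] -/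
theorem dist1_chart_square_corners {θc θc' rc Db : ℝ} (hθc : 0 < θc)
    (T : GaugeField P j (Matrix.specialUnitaryGroup (Fin 2) ℂ) → GaugeField Q i (Matrix.specialUnitaryGroup (Fin 2) ℂ))
    (DP : Plaq Q i → PBond P j → ℝ)
    (hdisp : ∀ (U : GaugeField P j (Matrix.specialUnitaryGroup (Fin 2) ℂ)), PlaqSmall θc' U →
      ∀ (b : PBond P j) (v : Fin 3 → ℝ), ‖v‖ ≤ rc * θc → ∀ s ∈ Icc (0 : ℝ) 1, ∀ p : Plaq Q i,
        dist1 (GaugeField.plaqHol (T (update U b (U b * expPt (s • v)))) p)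
          ≤ dist1 (GaugeField.plaqHol (T U) p) + DP p b * (‖v‖ / θc))
    (hDb0 : 0 ≤ Db) (hDb : ∀ p b, DP p b ≤ Db)
    {b b' : PBond P j} {v v' : Fin 3 → ℝ} {U V W Y : GaugeField P j (Matrix.specialUnitaryGroup (Fin 2) ℂ)}
    (hv : ‖v‖ ≤ rc * θc) (hv' : ‖v'‖ ≤ rc * θc)
    (hU : PlaqSmall θc' U) (hV : PlaqSmall θc' V) (hW : PlaqSmall θc' W) (hY : PlaqSmall θc' Y)
    (hVoff : ∀ e, e ≠ b → V e = U e) (hVon : V b = U b * expPt v) (hWoff : ∀ e, e ≠ b' → W e = U e) (hWon : W b' = U b' * expPt v')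
    (hYoff : ∀ e, e ≠ b' → Y e = V e) (hYon : Y b' = V b' * expPt v') (p : Plaq Q i) :
    (dist1 (GaugeField.plaqHol (T V) p) ≤ dist1 (GaugeField.plaqHol (T U) p) + Db * rc ∧
      dist1 (GaugeField.plaqHol (T U) p) ≤ dist1 (GaugeField.plaqHol (T V) p) + Db * rc) ∧
    (dist1 (GaugeField.plaqHol (T W) p) ≤ dist1 (GaugeField.plaqHol (T U) p) + Db * rc ∧
      dist1 (GaugeField.plaqHol (T U) p) ≤ dist1 (GaugeField.plaqHol (T W) p) + Db * rc) ∧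
    (dist1 (GaugeField.plaqHol (T Y) p) ≤ dist1 (GaugeField.plaqHol (T V) p) + Db * rc ∧
      dist1 (GaugeField.plaqHol (T V) p) ≤ dist1 (GaugeField.plaqHol (T Y) p) + Db * rc) ∧
    (dist1 (GaugeField.plaqHol (T Y) p) ≤ dist1 (GaugeField.plaqHol (T U) p) + 2 * (Db * rc) ∧
      dist1 (GaugeField.plaqHol (T U) p) ≤ dist1 (GaugeField.plaqHol (T Y) p) + 2 * (Db * rc)) ∧
    (dist1 (GaugeField.plaqHol (T W) p) ≤ dist1 (GaugeField.plaqHol (T V) p) + 2 * (Db * rc) ∧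
      dist1 (GaugeField.plaqHol (T V) p) ≤ dist1 (GaugeField.plaqHol (T W) p) + 2 * (Db * rc)) ∧
    (dist1 (GaugeField.plaqHol (T Y) p) ≤ dist1 (GaugeField.plaqHol (T W) p) + 3 * (Db * rc) ∧
      dist1 (GaugeField.plaqHol (T W) p) ≤ dist1 (GaugeField.plaqHol (T Y) p) + 3 * (Db * rc)) := by
  have hUV := dist1_chart_rel_le hθc T DP hdisp hDb0 hDb hVoff hVon hv hU p
  have hVU := dist1_chart_le_rel hθc T DP hdisp hDb0 hDb hVoff hVon hv hV p
  have hUW := dist1_chart_rel_le hθc T DP hdisp hDb0 hDb hWoff hWon hv' hU p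
  have hWU := dist1_chart_le_rel hθc T DP hdisp hDb0 hDb hWoff hWon hv' hW p
  have hVY := dist1_chart_rel_le hθc T DP hdisp hDb0 hDb hYoff hYon hv' hV p
  have hYV := dist1_chart_le_rel hθc T DP hdisp hDb0 hDb hYoff hYon hv' hY p
  refine ⟨⟨hUV, hVU⟩, ⟨hUW, hWU⟩, ⟨hVY, hYV⟩, ⟨?_, ?_⟩, ⟨?_, ?_⟩, ⟨?_, ?_⟩⟩ <;> linarith

/-- ★ **ANY TWO CORNERS** of one admissible square differ by at most `3·(Db·rc)` plaquette-wise in `dist1` (LEAD №42 (N2); the uniform count of this file: `k = 3`;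
`0 ≤ rc`). [folklore] -/
theorem dist1_chart_corner_corner_le {θc θc' rc Db : ℝ} (hθc : 0 < θc) (hrc : 0 ≤ rc)
    (T : GaugeField P j (Matrix.specialUnitaryGroup (Fin 2) ℂ) → GaugeField Q i (Matrix.specialUnitaryGroup (Fin 2) ℂ))
    (DP : Plaq Q i → PBond P j → ℝ)
    (hdisp : ∀ (U : GaugeField P j (Matrix.specialUnitaryGroup (Fin 2) ℂ)), PlaqSmall θc' U →
      ∀ (b : PBond P j) (v : Fin 3 → ℝ), ‖v‖ ≤ rc * θc → ∀ s ∈ Icc (0 : ℝ) 1, ∀ p : Plaq Q i,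
        dist1 (GaugeField.plaqHol (T (update U b (U b * expPt (s • v)))) p)
          ≤ dist1 (GaugeField.plaqHol (T U) p) + DP p b * (‖v‖ / θc))
    (hDb0 : 0 ≤ Db) (hDb : ∀ p b, DP p b ≤ Db)
    {b b' : PBond P j} {v v' : Fin 3 → ℝ} {U V W Y : GaugeField P j (Matrix.specialUnitaryGroup (Fin 2) ℂ)}
    (hv : ‖v‖ ≤ rc * θc) (hv' : ‖v'‖ ≤ rc * θc)
    (hU : PlaqSmall θc' U) (hV : PlaqSmall θc' V) (hW : PlaqSmall θc' W) (hY : PlaqSmall θc' Y)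
    (hVoff : ∀ e, e ≠ b → V e = U e) (hVon : V b = U b * expPt v) (hWoff : ∀ e, e ≠ b' → W e = U e) (hWon : W b' = U b' * expPt v')
    (hYoff : ∀ e, e ≠ b' → Y e = V e) (hYon : Y b' = V b' * expPt v')
    {X Xw : GaugeField P j (Matrix.specialUnitaryGroup (Fin 2) ℂ)}
    (hX : X = U ∨ X = V ∨ X = W ∨ X = Y) (hXw : Xw = U ∨ Xw = V ∨ Xw = W ∨ Xw = Y) (p : Plaq Q i) :
    dist1 (GaugeField.plaqHol (T X) p) ≤ dist1 (GaugeField.plaqHol (T Xw) p) + 3 * (Db * rc) := by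
  obtain ⟨⟨hUV, hVU⟩, ⟨hUW, hWU⟩, ⟨hVY, hYV⟩, ⟨hUY, hYU⟩, ⟨hVW, hWV⟩, ⟨hWY, hYW⟩⟩ :=
    dist1_chart_square_corners hθc T DP hdisp hDb0 hDb hv hv' hU hV hW hY hVoff hVon hWoff hWon hYoff hYon p
  have hD : 0 ≤ Db * rc := mul_nonneg hDb0 hrc
  rcases hX with rfl | rfl | rfl | rfl <;> rcases hXw with rfl | rfl | rfl | rfl <;> linarith

/-- ★ **RELATIONAL SQUARE POINT** (LEAD №42 (N3)): `Y` the `B`-path from `V00` (move `m`), `X s s′` the `B′`-move (`m′`) of `Y s`; `‖m‖, ‖m′‖ ≤ rc·θc`, `|s|, |s′| ≤ 1`,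
`V00`, `Y s`, `X s s′` in the `θc′`-window: `X s s′ ↔ V00` within `2·(Db·rc)` both ways. [folklore] -/
theorem dist1_chart_relSquare {θc θc' rc Db : ℝ} (hθc : 0 < θc)
    (T : GaugeField P j (Matrix.specialUnitaryGroup (Fin 2) ℂ) → GaugeField Q i (Matrix.specialUnitaryGroup (Fin 2) ℂ))
    (DP : Plaq Q i → PBond P j → ℝ)
    (hdisp : ∀ (U : GaugeField P j (Matrix.specialUnitaryGroup (Fin 2) ℂ)), PlaqSmall θc' U →
      ∀ (b : PBond P j) (v : Fin 3 → ℝ), ‖v‖ ≤ rc * θc → ∀ s ∈ Icc (0 : ℝ) 1, ∀ p : Plaq Q i,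
        dist1 (GaugeField.plaqHol (T (update U b (U b * expPt (s • v)))) p)
          ≤ dist1 (GaugeField.plaqHol (T U) p) + DP p b * (‖v‖ / θc))
    (hDb0 : 0 ≤ Db) (hDb : ∀ p b, DP p b ≤ Db)
    {B B' : PBond P j} {m m' : Fin 3 → ℝ} {V00 : GaugeField P j (Matrix.specialUnitaryGroup (Fin 2) ℂ)}
    {Y : ℝ → GaugeField P j (Matrix.specialUnitaryGroup (Fin 2) ℂ)} {X : ℝ → ℝ → GaugeField P j (Matrix.specialUnitaryGroup (Fin 2) ℂ)}
    (hm : ‖m‖ ≤ rc * θc) (hm' : ‖m'‖ ≤ rc * θc)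
    (hYoff : ∀ s e, e ≠ B → Y s e = V00 e) (hYon : ∀ s, Y s B = V00 B * expPt (s • m))
    (hXoff : ∀ s s' e, e ≠ B' → X s s' e = Y s e) (hXon : ∀ s s', X s s' B' = Y s B' * expPt (s' • m'))
    {s s' : ℝ} (hs : |s| ≤ 1) (hs' : |s'| ≤ 1)
    (hV : PlaqSmall θc' V00) (hYs : PlaqSmall θc' (Y s)) (hXss : PlaqSmall θc' (X s s')) (p : Plaq Q i) :
    dist1 (GaugeField.plaqHol (T (X s s')) p) ≤ dist1 (GaugeField.plaqHol (T V00) p) + 2 * (Db * rc) ∧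
      dist1 (GaugeField.plaqHol (T V00) p) ≤ dist1 (GaugeField.plaqHol (T (X s s')) p) + 2 * (Db * rc) := by
  have h1 := dist1_chart_relPath_le hθc T DP hdisp hDb0 hDb hYoff hYon hm hV hs p
  have h1' := dist1_chart_le_relPath hθc T DP hdisp hDb0 hDb hYoff hYon hm hs hYs p
  have h2 := dist1_chart_relPath_le hθc T DP hdisp hDb0 hDb (U := Y s) (X := fun t => X s t)
    (fun t e he => hXoff s t e he) (fun t => hXon s t) hm' hYs hs' p
  have h2' := dist1_chart_le_relPath hθc T DP hdisp hDb0 hDb (U := Y s) (X := fun t => X s t)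
    (fun t e he => hXoff s t e he) (fun t => hXon s t) hm' hs' hXss p
  constructor <;> linarith

/-! ## §3 Docking, generic: a near bound moves window membership from the law point to the value point; square stability from a LAW CORNER -/

omit [DecidableEq (PBond P j)] in
/-- A plaquette-wise `dist1` bound `≤ · + D` against a `θw`-small field gives `(θw + D)`-smallness. [folklore] -/
theorem plaqSmall_of_near {θw D : ℝ} {Uf Xf : GaugeField Q i (Matrix.specialUnitaryGroup (Fin 2) ℂ)}
    (hnear : ∀ p, dist1 (GaugeField.plaqHol Uf p) ≤ dist1 (GaugeField.plaqHol Xf p) + D) (hX : PlaqSmall θw Xf) :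
    PlaqSmall (θw + D) Uf := fun p => by
  have h1 := hnear p
  have h2 := hX p
  linarith

/-- ★ **SQUARE STABILITY FROM A LAW CORNER** (= ✓p816275 `plaqSmall_chart_along_square_of_lawPoint` with the window-to-window letter `hglob` REPLACED by «the law point `Xw` is
a corner of the square»): `T Xw ∈ PlaqSmall θw` at a corner + the clause + room `θw + 4·Db·rc ≤ θf` (≤ 2 moves corner → base `U`, then `(Db + Db)·rc` along the family) ⟹
the whole one-bond exponential square family from `U` maps into `PlaqSmall θf`. [folklore] -/
theorem plaqSmall_chart_along_square_of_lawCorner {θc θc' rc Db θw θf : ℝ} (hθc : 0 < θc) (hrc : 0 ≤ rc)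
    (T : GaugeField P j (Matrix.specialUnitaryGroup (Fin 2) ℂ) → GaugeField Q i (Matrix.specialUnitaryGroup (Fin 2) ℂ))
    (DP : Plaq Q i → PBond P j → ℝ)
    (hdisp : ∀ (U : GaugeField P j (Matrix.specialUnitaryGroup (Fin 2) ℂ)), PlaqSmall θc' U →
      ∀ (b : PBond P j) (v : Fin 3 → ℝ), ‖v‖ ≤ rc * θc → ∀ s ∈ Icc (0 : ℝ) 1, ∀ p : Plaq Q i,
        dist1 (GaugeField.plaqHol (T (update U b (U b * expPt (s • v)))) p)
          ≤ dist1 (GaugeField.plaqHol (T U) p) + DP p b * (‖v‖ / θc))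
    (hDb0 : 0 ≤ Db) (hDb : ∀ p b, DP p b ≤ Db)
    {b b' : PBond P j} {v v' : Fin 3 → ℝ} {U V W Y : GaugeField P j (Matrix.specialUnitaryGroup (Fin 2) ℂ)}
    (hv : ‖v‖ ≤ rc * θc) (hv' : ‖v'‖ ≤ rc * θc)
    (hU : PlaqSmall θc' U) (hV : PlaqSmall θc' V) (hW : PlaqSmall θc' W) (hY : PlaqSmall θc' Y)
    (hVoff : ∀ e, e ≠ b → V e = U e) (hVon : V b = U b * expPt v) (hWoff : ∀ e, e ≠ b' → W e = U e) (hWon : W b' = U b' * expPt v')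
    (hYoff : ∀ e, e ≠ b' → Y e = V e) (hYon : Y b' = V b' * expPt v')
    (hsqc : ∀ s ∈ Icc (0 : ℝ) 1, PlaqSmall θc' (update U b (U b * expPt (s • v))))
    {Xw : GaugeField P j (Matrix.specialUnitaryGroup (Fin 2) ℂ)} (hXw : Xw = U ∨ Xw = V ∨ Xw = W ∨ Xw = Y) (hTXw : PlaqSmall θw (T Xw))
    (hroom : θw + 4 * (Db * rc) ≤ θf) :
    ∀ s ∈ Icc (0 : ℝ) 1, ∀ t ∈ Icc (0 : ℝ) 1,
      PlaqSmall θf (T (update (update U b (U b * expPt (s • v))) b' ((update U b (U b * expPt (s • v))) b' * expPt (t • v')))) := by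
  have hcs := fun p =>
    dist1_chart_square_corners hθc T DP hdisp hDb0 hDb hv hv' hU hV hW hY hVoff hVon hWoff hWon hYoff hYon p
  have hD : 0 ≤ Db * rc := mul_nonneg hDb0 hrc
  -- the base `U` is within two moves of any corner
  have hTU : PlaqSmall (θw + 2 * (Db * rc)) (T U) := by
    refine plaqSmall_of_near (fun p => ?_) hTXw
    obtain ⟨⟨-, hVU⟩, ⟨-, hWU⟩, -, ⟨-, hYU⟩, -, -⟩ := hcs p
    rcases hXw with rfl | rfl | rfl | rfl <;> linarith
  exact plaqSmall_chart_along_square_of_margin hθc T DP hdisp b b' v v' U hv hv' hU hsqc hDb0 hDb0 (fun p => hDb p b) (fun p => hDb p b')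
    hTU (by linarith)

end Generic

end Summit.QuantumFields.YangMills.Theorems.OrganTangentNearDisplacement

end
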